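import Literature.MathematicalPhysics.QuantumManyBody.PeriodicFeynmanKacPerronFrobenius
import Literature.MathematicalPhysics.QuantumManyBody.GroundStateFeynmanKacWitnessSymm
import HarnessLib

/-!
# Proof of `PeriodicGroundStateFeynmanKac`, I: the top eigenfunction on the torus and its Bose symmetry

Topic `Literature/MathematicalPhysics/QuantumManyBody`; theorems only (no definition, no named
fact). First of three files discharging the named fact
`Literature.MathematicalPhysics.QuantumManyBody.BoseGas.PeriodicGroundStateFeynmanKac` of
`PeriodicHeatFlowSpectral.lean` (the torus twin of `GroundStateFeynmanKac_holds`,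
`GroundStateFeynmanKacProofs.lean` Part IV), from the Perron–Frobenius data of
`PeriodicFeynmanKacPerronFrobenius.lean`: for a measurable pair potential `v` with bounded
periodisation `v^per ≤ C` and `L > 0`, the compact positive positivity-improving operator
`T_1 = e^{-H_N^per} = pfkL2 v L 1` on `L²([0,L)^{3N})` has a unit eigenvector `e ≥ 0` for
`μ₀ = ‖T_1‖ > 0` spanning the `μ₀`-eigenspace (`pfkL2_perronFrobenius`). A class
`e ∈ L²(cell)` is read on `(ℝ³)^N` through the PERIODIC REPRESENTATIVE `|e ∘ cellProj L|`
(reduction to the cell, `PeriodicFeynmanKacCell.lean`), which is measurable, `Lℤ³`-periodic,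
square integrable on the cell, equal to `e` a.e. on the cell and not a.e. zero. Proved here:

* `cellProj_relabel` (and the private `measurePreserving_relabel_cellN`) — relabelling the
  particles `X ↦ X ∘ σ` commutes with the reduction and preserves Lebesgue measure on the cell;
* `pfkL2_eigenvector_rpow` — **`T_t e = μ₀ᵗ e` for all `t > 0`** (abstract:
  `semigroup_apply_eigenvector`, `coeff_eq_rpow` of `GroundStateFeynmanKacSpectral.lean` for the
  symmetric positive contraction semigroup `pfkL2 v L ·`; Chung–Zhao §8.3 (29));
* `pfkReal_abs_coeFn_cellProj_ae_eq(_cellN)` — the eigen-relation read on functions: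
  `e^{-tH}|e ∘ cellProj L| = μ₀ᵗ e` a.e. on the cell, `= μ₀ᵗ |e ∘ cellProj L|` a.e. on `(ℝ³)^N`;
* `abs_coeFn_relabel_ae_eq_cellN` — **Bose symmetry of the top eigenfunction**: `|e| ∘ (· ∘ σ) = |e|`
  a.e. on the cell (the relabelled class is again a nonnegative unit `μ₀`-eigenvector, hence `= e`
  by nondegeneracy; Reed–Simon IV §XIII.12, remark after Thm XIII.46), and its pointwise
  consequence `periodicWitness_symm` for the function `Ψ₀ = μ₀⁻¹ e^{-H}|e ∘ cellProj L|`
  (the witness of the sequel `PeriodicGroundStateFeynmanKacProofsWitness.lean`).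

## References

* M. Reed, B. Simon, *Methods of Modern Mathematical Physics IV: Analysis of Operators*,
  Academic Press (1978), §XIII.12, Thm XIII.44 and the remark after Thm XIII.46. [ReedSimonIV1978]
* K. L. Chung, Z. Zhao, *From Brownian Motion to Schrödinger's Equation*, Grundlehren 312,
  Springer (1995), §3.2 (26), Thm 3.10, §8.3 (29). [ChungZhao1995]
* J. Glimm, A. Jaffe, *Quantum Physics*, 2nd ed., Springer (1987), §3.3 Thms 3.3.2–3.3.3.
  [GlimmJaffeQP1987]
-/

noncomputable section

namespace Literature.MathematicalPhysics.QuantumManyBody.BoseGas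

open MeasureTheory ProbabilityTheory Filter Set
open scoped ENNReal NNReal Topology InnerProductSpace
open Literature.Probability.Process

variable {N : ℕ}

/-! ### Relabelling the particles on the cell -/

/-- The fundamental cell is invariant under relabelling of the particles (private: a Literature
copy of the Summit-side `relabel_preimage_cellN`, which lives outside the Literature import cone).
[folklore] -/
private theorem preimage_relabel_cellN (σ : Equiv.Perm (Fin N)) (L : ℝ) :
    (fun X : Config N => X ∘ σ) ⁻¹' cellN N L = cellN N L := by
  ext X
  exact ⟨fun h i => by simpa using h (σ.symm i), fun h i => h (σ i)⟩

/-- **Relabelling the particles preserves Lebesgue measure restricted to the cell** (private: a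
Literature copy of the Summit-side `measurePreserving_relabel_restrict_cellN`, which lives outside
the Literature import cone). [folklore] -/
private theorem measurePreserving_relabel_cellN (σ : Equiv.Perm (Fin N)) (L : ℝ) :
    MeasurePreserving (fun X : Config N => X ∘ σ) (volume.restrict (cellN N L))
      (volume.restrict (cellN N L)) := by
  simpa only [preimage_relabel_cellN] using
    (measurePreserving_relabel σ).restrict_preimage (measurableSet_cellN N L)

/-- **The reduction to the cell acts particle by particle**, so it commutes with relabelling:
`cellProj L (Y ∘ σ) = cellProj L Y ∘ σ`. [folklore] -/
theorem cellProj_relabel (L : ℝ) (σ : Equiv.Perm (Fin N)) (Y : Config N) :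
    cellProj L (Y ∘ σ) = cellProj L Y ∘ σ := by
  funext i
  simp only [cellProj, Pi.sub_apply, Function.comp_apply, latticeVecN]
  rfl

/-! ### The periodic representative `|e ∘ cellProj L|` of a nonnegative class `e ∈ L²(cell)` -/

section Rep

variable {L : ℝ} {e : Lp ℝ 2 (volume.restrict (cellN N L))}

/-- `|e ∘ cellProj L|` is measurable. [folklore] -/
theorem measurable_abs_coeFn_cellProj (e : Lp ℝ 2 (volume.restrict (cellN N L))) :
    Measurable fun Y => |(e : Config N → ℝ) (cellProj L Y)| :=
  ((measurable_coeFn_Lp_cellN e).comp (measurable_cellProj L)).abs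

/-- `|e ∘ cellProj L|` is `Lℤ³`-periodic in every particle. [folklore] -/
theorem abs_coeFn_cellProj_periodic (hL : L ≠ 0) (e : Lp ℝ 2 (volume.restrict (cellN N L)))
    (Y : Config N) (i : Fin N) (k : Fin 3) :
    |(e : Config N → ℝ) (cellProj L (Y + Pi.single i (EuclideanSpace.single k L)))| =
      |(e : Config N → ℝ) (cellProj L Y)| := by
  rw [cellProj_add_single hL]

/-- For `e ≥ 0`: `|e ∘ cellProj L| = e ∘ cellProj L` a.e. on `(ℝ³)^N`. [folklore] -/
theorem abs_coeFn_cellProj_ae_eq (hL : 0 < L) (he0 : 0 ≤ e) :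
    (fun Y => |(e : Config N → ℝ) (cellProj L Y)|) =ᵐ[(volume : Measure (Config N))]
      (e : Config N → ℝ) ∘ cellProj L := by
  have h : (fun Y => |(e : Config N → ℝ) Y|) =ᵐ[volume.restrict (cellN N L)]
      (e : Config N → ℝ) := by
    filter_upwards [(Lp.coeFn_nonneg e).2 he0] with Y hY
    exact abs_of_nonneg hY
  exact ae_comp_cellProj hL h

/-- For `e ≥ 0`: `|e ∘ cellProj L| = e` a.e. on the cell. [folklore] -/
theorem abs_coeFn_cellProj_ae_eq_cellN (hL : 0 < L) (he0 : 0 ≤ e) :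
    (fun Y => |(e : Config N → ℝ) (cellProj L Y)|) =ᵐ[volume.restrict (cellN N L)]
      (e : Config N → ℝ) := by
  filter_upwards [(Lp.coeFn_nonneg e).2 he0, ae_restrict_mem (measurableSet_cellN N L)]
    with Y hY hYc
  rw [cellProj_of_mem_cellN hL hYc]
  exact abs_of_nonneg hY

/-- `|e ∘ cellProj L|` has the (finite) squared cell mass of `e`. [folklore] -/
theorem setLIntegral_cellN_abs_coeFn_cellProj_sq (hL : 0 < L)
    (e : Lp ℝ 2 (volume.restrict (cellN N L))) :
    ∫⁻ Y in cellN N L, ‖|(e : Config N → ℝ) (cellProj L Y)|‖ₑ ^ (2 : ℝ) =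
      ∫⁻ Y in cellN N L, ‖(e : Config N → ℝ) Y‖ₑ ^ (2 : ℝ) := by
  simp only [Real.enorm_abs]
  exact setLIntegral_cellN_enorm_comp_cellProj_sq hL e

/-- `|e ∘ cellProj L|` is square integrable on the cell. [folklore] -/
theorem setLIntegral_cellN_abs_coeFn_cellProj_sq_ne_top (hL : 0 < L)
    (e : Lp ℝ 2 (volume.restrict (cellN N L))) :
    ∫⁻ Y in cellN N L, ‖|(e : Config N → ℝ) (cellProj L Y)|‖ₑ ^ (2 : ℝ) ≠ ⊤ := by
  rw [setLIntegral_cellN_abs_coeFn_cellProj_sq hL]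
  exact setLIntegral_cellN_enorm_sq_ne_top e

/-- `|e ∘ cellProj L|` is not a.e. zero on the cell when `e ≥ 0` is a unit vector. [folklore] -/
theorem abs_coeFn_cellProj_not_ae_zero (hL : 0 < L) (he1 : ‖e‖ = 1) (he0 : 0 ≤ e) :
    ¬ (fun Y => |(e : Config N → ℝ) (cellProj L Y)|) =ᵐ[volume.restrict (cellN N L)] 0 := by
  intro h
  have h1 : (e : Config N → ℝ) =ᵐ[volume.restrict (cellN N L)] 0 :=
    (abs_coeFn_cellProj_ae_eq_cellN hL he0).symm.trans h
  have := Lp.eq_zero_iff_ae_eq_zero.2 h1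
  rw [this, norm_zero] at he1
  exact zero_ne_one he1

end Rep

/-! ### The `L²(cell)` eigen-relation at all times, read on functions -/

section Eigen

variable {v : ℝ → ℝ≥0∞} {L : ℝ} {C : ℝ≥0} {e : Lp ℝ 2 (volume.restrict (cellN N L))}

/-- **`e^{-tH} e = ‖e^{-H}‖ᵗ e` for every `t > 0`** for the Perron–Frobenius unit eigenvector `e`
of `e^{-H} = pfkL2 v L 1` spanning its top eigenspace: the abstract `semigroup_apply_eigenvector`
and `coeff_eq_rpow` for the symmetric positive contraction semigroup `pfkL2 v L ·` on `L²(cell)`.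
Chung–Zhao (1995), §8.3 (29). [folklore] -/
theorem pfkL2_eigenvector_rpow (hv : Measurable v) (hL : 0 < L)
    (hC : ∀ x, periodizedPotential v L x ≤ C) (he1 : ‖e‖ = 1)
    (hTe : pfkL2 v L 1 e = ‖pfkL2 (N := N) v L 1‖ • e)
    (hsimple : ∀ f, pfkL2 v L 1 f = ‖pfkL2 (N := N) v L 1‖ • f → ∃ c : ℝ, f = c • e)
    {t : ℝ} (ht : 0 < t) : pfkL2 v L t e = (‖pfkL2 (N := N) v L 1‖ ^ t) • e := by
  have hadd : ∀ s t : ℝ, 0 < s → 0 < t →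
      pfkL2 (N := N) v L (s + t) = (pfkL2 v L s).comp (pfkL2 v L t) :=
    fun s t hs ht => pfkL2_add_time hv hL hs ht
  have hcontr : ∀ t : ℝ, 0 < t → ‖pfkL2 (N := N) v L t‖ ≤ 1 := fun t _ => norm_pfkL2_le_one v L t
  have hpos : ∀ t : ℝ, 0 < t → ∀ x : Lp ℝ 2 (volume.restrict (cellN N L)),
      0 ≤ ⟪pfkL2 v L t x, x⟫_ℝ := fun t ht x => inner_pfkL2_self_nonneg hv hL ht x
  have hμ₀ : 0 < ‖pfkL2 (N := N) v L 1‖ :=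
    norm_pos_iff.2 (pfkL2_perronFrobenius (N := N) hv hL hC one_pos).1
  rw [semigroup_apply_eigenvector (S := fun t => pfkL2 (N := N) v L t) hadd he1 hTe hsimple ht,
    coeff_eq_rpow (S := fun t => pfkL2 (N := N) v L t) hadd hcontr hpos he1 hTe hsimple hμ₀ ht]

/-- **`e^{-tH} |e ∘ cellProj L| = ‖e^{-H}‖ᵗ e` a.e. on the cell** (`t > 0`, `e ≥ 0`): the `L²`
eigen-relation read through the periodic representative. [folklore] -/
theorem pfkReal_abs_coeFn_cellProj_ae_eq_cellN (hv : Measurable v) (hL : 0 < L)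
    (hC : ∀ x, periodizedPotential v L x ≤ C) (he1 : ‖e‖ = 1) (he0 : 0 ≤ e)
    (hTe : pfkL2 v L 1 e = ‖pfkL2 (N := N) v L 1‖ • e)
    (hsimple : ∀ f, pfkL2 v L 1 f = ‖pfkL2 (N := N) v L 1‖ • f → ∃ c : ℝ, f = c • e)
    {t : ℝ} (ht : 0 < t) :
    pfkReal v L t (fun Y => |(e : Config N → ℝ) (cellProj L Y)|)
      =ᵐ[volume.restrict (cellN N L)] fun Y => ‖pfkL2 (N := N) v L 1‖ ^ t * (e : Config N → ℝ) Y := by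
  have h1 : ((pfkL2 v L t e : Lp ℝ 2 (volume.restrict (cellN N L))) : Config N → ℝ)
      =ᵐ[volume.restrict (cellN N L)] pfkReal v L t (⇑e ∘ cellProj L) := pfkL2_coeFn hv hL ht e
  rw [pfkL2_eigenvector_rpow hv hL hC he1 hTe hsimple ht] at h1
  have h2 : pfkReal v L t (fun Y => |(e : Config N → ℝ) (cellProj L Y)|) =
      pfkReal v L t (⇑e ∘ cellProj L) :=
    funext fun Y => pfkReal_congr_ae v L ht (abs_coeFn_cellProj_ae_eq hL he0) Y
  filter_upwards [h1, Lp.coeFn_smul (‖pfkL2 (N := N) v L 1‖ ^ t) e] with Y hY1 hY2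
  rw [h2, ← hY1, hY2, Pi.smul_apply, smul_eq_mul]

/-- **`e^{-tH} |e ∘ cellProj L| = ‖e^{-H}‖ᵗ |e ∘ cellProj L|` a.e. on `(ℝ³)^N`** (`t > 0`; both
sides are periodic, and they agree a.e. on the cell). [folklore] -/
theorem pfkReal_abs_coeFn_cellProj_ae_eq (hv : Measurable v) (hL : 0 < L)
    (hC : ∀ x, periodizedPotential v L x ≤ C) (he1 : ‖e‖ = 1) (he0 : 0 ≤ e)
    (hTe : pfkL2 v L 1 e = ‖pfkL2 (N := N) v L 1‖ • e)
    (hsimple : ∀ f, pfkL2 v L 1 f = ‖pfkL2 (N := N) v L 1‖ • f → ∃ c : ℝ, f = c • e)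
    {t : ℝ} (ht : 0 < t) :
    pfkReal v L t (fun Y => |(e : Config N → ℝ) (cellProj L Y)|) =ᵐ[(volume : Measure (Config N))]
      fun Y => ‖pfkL2 (N := N) v L 1‖ ^ t * |(e : Config N → ℝ) (cellProj L Y)| := by
  refine ae_eq_of_periodic_of_ae_eq_cellN hL
    (pfkReal_add_single_of_periodic v L t (abs_coeFn_cellProj_periodic hL.ne' e))
    (fun Y i k => by rw [abs_coeFn_cellProj_periodic hL.ne' e]) ?_
  filter_upwards [pfkReal_abs_coeFn_cellProj_ae_eq_cellN hv hL hC he1 he0 hTe hsimple ht,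
    abs_coeFn_cellProj_ae_eq_cellN hL he0] with Y hY1 hY2
  rw [hY1, hY2]

end Eigen

/-! ### Bose symmetry of the witness -/

section Symm

variable {v : ℝ → ℝ≥0∞} {L : ℝ} {C : ℝ≥0} {e : Lp ℝ 2 (volume.restrict (cellN N L))}
  {Ψ₀ : Config N → ℝ}

/-- **The relabelled top eigenfunction is the top eigenfunction, a.e. on the cell**:
`|e| ∘ (· ∘ σ) = |e|` a.e. on `[0,L)^{3N}` for every permutation `σ` of the particles — the class of
`|e| ∘ (· ∘ σ)` is again a nonnegative unit eigenvector of `e^{-H}` for `‖e^{-H}‖` (relabelling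
commutes with the semigroup and preserves the measure of the cell), hence equals `e` by
nondegeneracy (Reed–Simon IV §XIII.12, remark after Thm XIII.46). [cite: ReedSimonIV1978, Thm XIII.44] -/
theorem abs_coeFn_relabel_ae_eq_cellN (hv : Measurable v) (hL : 0 < L)
    (hC : ∀ x, periodizedPotential v L x ≤ C) (he1 : ‖e‖ = 1) (he0 : 0 ≤ e)
    (hTe : pfkL2 v L 1 e = ‖pfkL2 (N := N) v L 1‖ • e)
    (hsimple : ∀ f, pfkL2 v L 1 f = ‖pfkL2 (N := N) v L 1‖ • f → ∃ c : ℝ, f = c • e)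
    (σ : Equiv.Perm (Fin N)) :
    (fun Y : Config N => |(e : Config N → ℝ) (Y ∘ σ)|) =ᵐ[volume.restrict (cellN N L)]
      fun Y => |(e : Config N → ℝ) Y| := by
  set μ₀ : ℝ := ‖pfkL2 (N := N) v L 1‖ with hμ₀def
  obtain ⟨ea, hea⟩ : ∃ ea : Config N → ℝ, ea = fun Y => |(e : Config N → ℝ) Y| := ⟨_, rfl⟩
  obtain ⟨ρ, hρ⟩ : ∃ ρ : Config N → Config N, ρ = fun Y => Y ∘ σ := ⟨_, rfl⟩
  have hgoal : (fun Y : Config N => |(e : Config N → ℝ) (Y ∘ σ)|) = ea ∘ ρ := by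
    rw [hea, hρ]; rfl
  rw [hgoal, ← hea]
  have hp : MeasurePreserving ρ (volume.restrict (cellN N L)) (volume.restrict (cellN N L)) := by
    rw [hρ]; exact measurePreserving_relabel_cellN (N := N) σ L
  have hmeas : Measurable ea := by rw [hea]; exact (measurable_coeFn_Lp_cellN e).abs
  have hea0 : ∀ Y, 0 ≤ ea Y := fun Y => by rw [hea]; exact abs_nonneg _
  have hea_ae : ea =ᵐ[volume.restrict (cellN N L)] (e : Config N → ℝ) := by
    rw [hea]
    filter_upwards [(Lp.coeFn_nonneg e).2 he0] with Y hY
    exact abs_of_nonneg hY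
  -- `e^{-H}(ea ∘ cellProj) = μ₀ e` a.e. on the cell
  have hTea : pfkReal v L 1 (ea ∘ cellProj L) =ᵐ[volume.restrict (cellN N L)]
      fun Y => μ₀ * (e : Config N → ℝ) Y := by
    have h := pfkReal_abs_coeFn_cellProj_ae_eq_cellN hv hL hC he1 he0 hTe hsimple one_pos
    rw [Real.rpow_one] at h
    rw [hea]
    exact h
  -- relabelling commutes with the periodic extension and with the semigroup
  have hcomm : (ea ∘ ρ) ∘ cellProj L = (ea ∘ cellProj L) ∘ ρ := by
    funext Y
    simp only [Function.comp_apply, hρ, cellProj_relabel]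
  have hcov : ∀ Y, pfkReal v L 1 ((ea ∘ ρ) ∘ cellProj L) Y = pfkReal v L 1 (ea ∘ cellProj L) (ρ Y) := by
    intro Y
    rw [hcomm, hρ]
    exact (pfkReal_comp_perm v L 1 (ea ∘ cellProj L) σ Y).symm
  -- the relabelled class `eσ`
  have hmem : MemLp ea 2 (volume.restrict (cellN N L)) := (Lp.memLp e).ae_eq hea_ae.symm
  have hmemσ : MemLp (ea ∘ ρ) 2 (volume.restrict (cellN N L)) := hmem.comp_measurePreserving hp
  obtain ⟨eσ, heσdef⟩ : ∃ x : Lp ℝ 2 (volume.restrict (cellN N L)), x = hmemσ.toLp _ := ⟨_, rfl⟩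
  have heσ : (eσ : Config N → ℝ) =ᵐ[volume.restrict (cellN N L)] (ea ∘ ρ) := by
    rw [heσdef]; exact hmemσ.coeFn_toLp
  have hstep : (pfkReal v L 1 (ea ∘ cellProj L) ∘ ρ) =ᵐ[volume.restrict (cellN N L)]
      ((fun Y => μ₀ * (e : Config N → ℝ) Y) ∘ ρ) :=
    hp.quasiMeasurePreserving.ae_eq_comp hTea
  have hea_aeσ : (ea ∘ ρ) =ᵐ[volume.restrict (cellN N L)] ((e : Config N → ℝ) ∘ ρ) :=
    hp.quasiMeasurePreserving.ae_eq_comp hea_ae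
  -- `e^{-H} eσ = μ₀ eσ`
  have hTσ : pfkL2 v L 1 eσ = μ₀ • eσ := by
    refine Lp.ext ?_
    filter_upwards [pfkL2_coeFn hv hL one_pos eσ, Lp.coeFn_smul μ₀ eσ, hstep, heσ, hea_aeσ]
      with Y h1 h2 h3 h4 h5
    rw [h1, pfkReal_comp_cellProj_congr_ae v hL one_pos heσ Y, hcov Y, h2, Pi.smul_apply,
      smul_eq_mul, h4, h5]
    exact h3
  obtain ⟨c, hc⟩ := hsimple eσ hTσ
  -- `‖eσ‖ = 1`, hence `|c| = 1`
  have hnorm : ‖eσ‖ = 1 := by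
    rw [heσdef, Lp.norm_toLp, eLpNorm_comp_measurePreserving hmem.aestronglyMeasurable hp,
      eLpNorm_congr_ae hea_ae, ← Lp.norm_def, he1]
  have hcabs : |c| = 1 := by
    have := congrArg norm hc
    rw [hnorm, norm_smul, he1, mul_one, Real.norm_eq_abs] at this
    exact this.symm
  have hcoe : (eσ : Config N → ℝ) =ᵐ[volume.restrict (cellN N L)]
      fun Y => c * (e : Config N → ℝ) Y := by
    have h1 : (eσ : Config N → ℝ) =ᵐ[volume.restrict (cellN N L)]
        ((c • e : Lp ℝ 2 (volume.restrict (cellN N L))) : Config N → ℝ) := by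
      rw [← hc]
    filter_upwards [h1, Lp.coeFn_smul c e] with Y hY1 hY2
    rw [hY1, hY2, Pi.smul_apply, smul_eq_mul]
  -- `c = 1`: both classes are nonnegative and nonzero
  have hc1 : c = 1 := by
    rcases (abs_eq zero_le_one).1 hcabs with h | h
    · exact h
    · exfalso
      have hzero : e = 0 := by
        rw [Lp.eq_zero_iff_ae_eq_zero]
        filter_upwards [heσ, (Lp.coeFn_nonneg e).2 he0, hcoe] with Y h1 h2 h3
        have h4 : 0 ≤ (eσ : Config N → ℝ) Y := by rw [h1]; exact hea0 _
        rw [h3, h] at h4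
        have h2' : 0 ≤ (e : Config N → ℝ) Y := h2
        rw [Pi.zero_apply]
        linarith
      rw [hzero, norm_zero] at he1
      exact zero_ne_one he1
  rw [hc1] at hcoe
  filter_upwards [heσ, hcoe, hea_ae] with Y h1 h2 h3
  rw [← h1, h2, one_mul, ← h3]

/-- **Bose symmetry of the witness**: `Ψ₀ (X ∘ σ) = Ψ₀ X` for every permutation `σ` and EVERY `X`
(the relabelled periodic representative agrees a.e. with the representative; `e^{-H}` commutes
with relabelling and does not see null modifications). [cite: ReedSimonIV1978, Thm XIII.44] -/
theorem periodicWitness_symm (hv : Measurable v) (hL : 0 < L)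
    (hC : ∀ x, periodizedPotential v L x ≤ C) (he1 : ‖e‖ = 1) (he0 : 0 ≤ e)
    (hTe : pfkL2 v L 1 e = ‖pfkL2 (N := N) v L 1‖ • e)
    (hsimple : ∀ f, pfkL2 v L 1 f = ‖pfkL2 (N := N) v L 1‖ • f → ∃ c : ℝ, f = c • e)
    (hΨ : ∀ X, Ψ₀ X = ‖pfkL2 (N := N) v L 1‖⁻¹ *
      pfkReal v L 1 (fun Y => |(e : Config N → ℝ) (cellProj L Y)|) X)
    (σ : Equiv.Perm (Fin N)) (X : Config N) : Ψ₀ (X ∘ σ) = Ψ₀ X := by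
  have hae : (fun Y : Config N => |(e : Config N → ℝ) (cellProj L (Y ∘ σ))|)
      =ᵐ[(volume : Measure (Config N))] fun Y => |(e : Config N → ℝ) (cellProj L Y)| := by
    have h := ae_comp_cellProj hL (abs_coeFn_relabel_ae_eq_cellN hv hL hC he1 he0 hTe hsimple σ)
    refine h.mono fun Y hY => ?_
    simp only [Function.comp_apply] at hY
    show |(e : Config N → ℝ) (cellProj L (Y ∘ σ))| = |(e : Config N → ℝ) (cellProj L Y)|
    rw [cellProj_relabel]
    exact hY
  rw [hΨ, hΨ, pfkReal_comp_perm v L 1 _ σ X]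
  exact congrArg _ (pfkReal_congr_ae v L one_pos hae X)

end Symm

end Literature.MathematicalPhysics.QuantumManyBody.BoseGas

end
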